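import Summits.ResolutionOfSingularities.ResolutionOfSingularities.Theorems.PurelyInseparableDim4ChartChain
import HarnessLib

/-!
# Purely inseparable four-folds `z^p + F(x₁, …, x₄)`: EXCEPTIONAL CHAINS — the closedness of the walk's
# centre PROPAGATES along steps with `S' ⊆ S''`, at any depth (brick TY-2 (h) part 4 of cell `res-dim4-pi`)

[OURS · counted 0] (D-0157 DOOR 2; director-resolution DR-157-C; frame `PIDim4.TerminationImpliesOrderReduction`,
S3 (c); typ-3 memo §B (c4)). Sequel of `PurelyInseparableDim4ChartChain.lean`. There, `depth_two` globalised the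
walk's SECOND centre when `S.erase j ⊆ S'`, using that the first ambient is `𝔸⁵` itself. At depth `≥ 3` the
ambient `Z` is an arbitrary blow-up tower and the chart centre `φ(V(z, x_{S'}))` is closed in `Z` only by
hypothesis (the INVARIANT below). This file proves that the hypothesis PROPAGATES to the next level whenever the
next centre contains ALL the current centre variables, `S' ⊆ S''` — i.e. the next centre lies in the newest
exceptional divisor (`j' ∈ S''`) and in the strict transforms of the hyperplanes `xᵢ = b'ᵢ x_{j'}`
(`S'.erase j' ⊆ S''`): the typical shape of a walk that keeps blowing up (sections over) an equimultiple locus of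
constant dimension. PROVED here (no `sorry`, no new axiom):

* §1 `isClosed_image_of_isInducing` — topology: along an inducing map, a closed set whose image has closure
  inside the range has closed image;
* §2 `comap_comap_globalCentre_chart_of_chart` — on the chart of the chart `φ'' = Spec Θ' ≫ chartImm_{j'} ≫ (π₂⁻¹ φ(𝔸⁵) ↪ W₂)`
  the exceptional ideal `π₂^* Z_c` reads `V(x_{j'})`; **`isClosed_image_CΛ_chart_of_chart`** — INVARIANT
  PROPAGATION: if `φ(V(z, x_{S'}))` is closed in `Z`, `π₂ : W₂ → Z` is any blowing up along its global centre
  `Z_c`, `j' ∈ S'`, `Θ'` a re-centring (`Θ' z = z + h'(x)`, `Θ' xᵢ = xᵢ + b'ᵢ`, `b'_{j'} = 0`) and `S' ⊆ S''`, then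
  `φ''(V(z, x_{S''}))` is CLOSED in `W₂` (it is closed in `π₂⁻¹ φ(𝔸⁵)` by the depth-one criterion for the
  restricted blow-up, and lies in `π₂⁻¹(φ(V(z, x_{S'})))`, a closed set inside that open);
* §3 **`coord_chain_step`** — THE INDUCTION STEP OF THE COORDINATE-CENTRE CHAIN, any ambient: from
  INVARIANT(Z, φ, M, s₁, S') = [`M` of multiplicity `p` reads `(z^p + s₁.F)·𝒪` on the open-immersion chart `φ`,
  `p ≤ ord_{(x_{S'})} s₁.F`, `φ(V(z, x_{S'}))` closed in `Z`] and ANY blowing up `π₂` along `Z_c`, for every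
  `j' ∈ S'`, `b'` (`b'_{j'} = 0`): a chart `φ''` of `W₂` on which `M.transform π₂ Z_c` reads
  `(z^p + (CentreBlowup.step p S' j' b' s₁).F)·𝒪` AND `φ''(V(z, x_{S''}))` is closed for every `S'' ⊇ S'` — the
  INVARIANT again for every next centre `S'' ⊇ S'` that is Hironaka-permissible for the next state; together with
  `isMultipleBlowup_extend_coord` (previous file; its simple-normal-crossings input stays a hypothesis — desk
  caveat FC-1 «boundary amnesia») this iterates `IsMultipleBlowup` along every branch of the walk whose centre
  variable sets increase, `S ⊆ S' ⊆ S'' ⊆ …` (after the first step, which needs only `S.erase j ⊆ S'`).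

What is NOT here: centres with `S' ⊄ S''` at depth `≥ 3` (their closedness depends on the fibre directions of
ALL earlier blow-ups — «centre escape»), and the boundary's simple normal crossings beyond depth 2. Nothing here
is a statement about resolution of singularities in dimension ≥ 4 / characteristic `p` (NOT proved anywhere in
this programme). bears_on: LADDER-RESOLUTION:D157-DOOR2 (res-dim4-pi). Supports
stmt-ResolutionOfSingularities-16155 (helper, TY-2 (h)).
-/

-- every declaration of this summit lives under `Summit.ResolutionOfSingularities.ResolutionOfSingularities`
-- (summit = problem), which the duplicate-namespace linter flags; house convention (cf. the Target file).
set_option linter.dupNamespace false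

noncomputable section

open MvPolynomial Finset CategoryTheory AlgebraicGeometry Opposite TopologicalSpace
open AlgebraicGeometry.Scheme.IdealSheafData (ofIdealTop vanishingIdeal)

namespace Summit.ResolutionOfSingularities.ResolutionOfSingularities.Theorems.PIDim4

open Literature.AlgebraicGeometry.Resolution
open Literature.AlgebraicGeometry.Resolution.AffinePointBlowup (P A γ coord Wtop)

namespace ChartDictionary

/-! ## §1 Topology: closed sets with closure of the image inside the range of an inducing map -/

/-- Along an inducing map `f` (e.g. an open immersion of schemes), a closed set `s` whose image has closure
inside the range of `f` has CLOSED image: `closure (f '' s) = f '' s`. -/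
theorem isClosed_image_of_isInducing {X Y : Type*} [TopologicalSpace X] [TopologicalSpace Y] {f : X → Y}
    (hf : Topology.IsInducing f) {s : Set X} (hs : IsClosed s) (hcl : closure (f '' s) ⊆ Set.range f) :
    IsClosed (f '' s) := by
  have hind := hf.closure_eq_preimage_closure_image s
  rw [hs.closure_eq] at hind
  have heq : f '' s = closure (f '' s) := by
    nth_rewrite 1 [hind]
    rw [Set.image_preimage_eq_inter_range, Set.inter_eq_left.mpr hcl]
  rw [heq]
  exact isClosed_closure

/-! ## §2 Propagation of closedness along a step with `S' ⊆ S''` -/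

section Step

variable {K : Type} [Field K] {Z W₂ : Scheme.{0}} (φ : P 4 K ⟶ Z) [IsOpenImmersion φ] {π₂ : W₂ ⟶ Z}
  {S' : Finset (Fin 4)} {j' : Fin 4}

/-- The exceptional ideal `π₂^* Z_c` restricted over the chart is the exceptional ideal of the restricted
blowing up `(π₂ |_{φ(𝔸⁵)}) ≫ e` of `𝔸⁵` along `V(z, x_{S'})`. -/
theorem comap_comap_globalCentre_restrict (Λ' : Set (Fin (4 + 1))) :
    ((vanishingIdeal (closureImage φ ((AffineCoordBlowup.𝓘Λ 4 K Λ').support : Set (P 4 K)))).comap π₂).comap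
        (π₂ ⁻¹ᵁ φ.opensRange).ι =
      (AffineCoordBlowup.𝓘Λ 4 K Λ').comap ((π₂ ∣_ φ.opensRange) ≫ φ.isoOpensRange.symm.hom) := by
  have hι : φ.isoOpensRange.inv ≫ φ = φ.opensRange.ι := by
    rw [Iso.inv_comp_eq, Scheme.Hom.isoOpensRange_hom_ι]
  rw [← Scheme.IdealSheafData.comap_comp, ← morphismRestrict_ι, Scheme.IdealSheafData.comap_comp, ← hι,
    Scheme.IdealSheafData.comap_comp, comap_globalCentre φ Λ', Iso.symm_hom, Scheme.IdealSheafData.comap_comp]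

/-- **On the chart of the chart the exceptional ideal `π₂^* Z_c` reads `V(x_{j'})`** (`j' ∈ S'`, `Θ'` fixing
`x_{j'}`). -/
theorem comap_comap_globalCentre_chart_of_chart (hj' : j' ∈ S') {Θ' : A 4 K →+* A 4 K}
    (hΘ'j : Θ' (X j'.succ) = X j'.succ)
    (hπ₂ : IsBlowup π₂ (vanishingIdeal (closureImage φ
      ((AffineCoordBlowup.𝓘Λ 4 K (insert 0 (Fin.succ '' (S' : Set (Fin 4))))).support : Set (P 4 K))))) :
    ((vanishingIdeal (closureImage φ
        ((AffineCoordBlowup.𝓘Λ 4 K (insert 0 (Fin.succ '' (S' : Set (Fin 4))))).support : Set (P 4 K)))).comap π₂).comap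
        (Spec.map (CommRingCat.ofHom Θ') ≫
          AffineCoordBlowup.chartImm (isBlowup_restrict_globalCentre φ _ hπ₂) (succ_mem_centreVars hj') ≫
            (π₂ ⁻¹ᵁ φ.opensRange).ι) =
      ofIdealTop (Ideal.span {coord 4 K j'.succ}) := by
  rw [← Category.assoc, Scheme.IdealSheafData.comap_comp, comap_comap_globalCentre_restrict φ]
  exact comap_exceptional_chart hj' hΘ'j (isBlowup_restrict_globalCentre φ _ hπ₂)

/-- **INVARIANT PROPAGATION (closedness of the next centre).** Let `φ : 𝔸⁵_K ⟶ Z` be an open-immersion chart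
with `φ(V(z, x_{S'}))` CLOSED in `Z`, `π₂ : W₂ → Z` any blowing up along its global centre `Z_c`, `j' ∈ S'`, `Θ'` a
re-centring automorphism (`Θ' z = z + h'(x)`, `Θ' xᵢ = xᵢ + b'ᵢ`, `b'_{j'} = 0`), and `S' ⊆ S''`. Then on the chart
of the chart `φ'' = Spec Θ' ≫ chartImm_{j'} ≫ (π₂⁻¹ φ(𝔸⁵) ↪ W₂)` the image `φ''(V(z, x_{S''}))` is CLOSED in `W₂`. -/
theorem isClosed_image_CΛ_chart_of_chart
    (hT : IsClosed (φ '' (AffineCoordBlowup.CΛ 4 K (insert 0 (Fin.succ '' (S' : Set (Fin 4)))) : Set (P 4 K))))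
    (hπ₂ : IsBlowup π₂ (vanishingIdeal (closureImage φ
      ((AffineCoordBlowup.𝓘Λ 4 K (insert 0 (Fin.succ '' (S' : Set (Fin 4))))).support : Set (P 4 K)))))
    (hj' : j' ∈ S') {b' : Fin 4 → K} (hbj' : b' j' = 0) {Θ' : A 4 K ≃ₐ[K] A 4 K} {h' : MvPolynomial (Fin 4) K}
    (h0' : Θ' (X 0) = X 0 + rename Fin.succ h') (hs' : ∀ i : Fin 4, Θ' (X i.succ) = X i.succ + C (b' i))
    {S'' : Finset (Fin 4)} (hsub : S' ⊆ S'') :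
    IsClosed ((Spec.map (CommRingCat.ofHom (Θ' : A 4 K →+* A 4 K)) ≫
        AffineCoordBlowup.chartImm (isBlowup_restrict_globalCentre φ _ hπ₂) (succ_mem_centreVars hj') ≫
          (π₂ ⁻¹ᵁ φ.opensRange).ι) ''
      (AffineCoordBlowup.CΛ 4 K (insert 0 (Fin.succ '' (S'' : Set (Fin 4)))) : Set (P 4 K))) := by
  haveI : IsIso (CommRingCat.ofHom (Θ' : A 4 K →+* A 4 K)) :=
    (inferInstance : IsIso Θ'.toRingEquiv.toCommRingCatIso.hom)
  have hΘ'j : (Θ' : A 4 K →+* A 4 K) (X j'.succ) = X j'.succ := by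
    rw [show (Θ' : A 4 K →+* A 4 K) (X j'.succ) = Θ' (X j'.succ) from rfl, hs' j', hbj', C_0, add_zero]
  -- (i) closed in the open `π₂⁻¹ φ(𝔸⁵)`: the depth-one criterion for the restricted blow-up
  have h1 := isClosed_image_CΛ_chart hj' hbj' h0' hs' (isBlowup_restrict_globalCentre φ _ hπ₂)
    ((Finset.erase_subset j' S').trans hsub)
  -- (ii) inside `π₂⁻¹ (φ(V(z, x_{S'})))`, a closed set inside the open
  have h2 : (Spec.map (CommRingCat.ofHom (Θ' : A 4 K →+* A 4 K)) ≫
        AffineCoordBlowup.chartImm (isBlowup_restrict_globalCentre φ _ hπ₂) (succ_mem_centreVars hj') ≫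
          (π₂ ⁻¹ᵁ φ.opensRange).ι) ''
      (AffineCoordBlowup.CΛ 4 K (insert 0 (Fin.succ '' (S'' : Set (Fin 4)))) : Set (P 4 K)) ⊆
      π₂ ⁻¹' (φ '' (AffineCoordBlowup.CΛ 4 K (insert 0 (Fin.succ '' (S' : Set (Fin 4)))) : Set (P 4 K))) := by
    have hle : ofIdealTop (Ideal.span {coord 4 K j'.succ}) ≤
        AffineCoordBlowup.𝓘Λ 4 K (insert 0 (Fin.succ '' (S'' : Set (Fin 4)))) :=
      ofIdealTop_span_le_𝓘Λ (Ideal.subset_span ⟨j'.succ, Set.mem_insert_of_mem _ ⟨j', hsub hj', rfl⟩, rfl⟩)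
    have hsupp : AffineCoordBlowup.CΛ 4 K (insert 0 (Fin.succ '' (S'' : Set (Fin 4)))) ≤
        (((vanishingIdeal (closureImage φ ((AffineCoordBlowup.𝓘Λ 4 K
          (insert 0 (Fin.succ '' (S' : Set (Fin 4))))).support : Set (P 4 K)))).comap π₂).comap
          (Spec.map (CommRingCat.ofHom (Θ' : A 4 K →+* A 4 K)) ≫
            AffineCoordBlowup.chartImm (isBlowup_restrict_globalCentre φ _ hπ₂) (succ_mem_centreVars hj') ≫
              (π₂ ⁻¹ᵁ φ.opensRange).ι)).support := by
      rw [comap_comap_globalCentre_chart_of_chart φ hj' hΘ'j hπ₂]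
      exact Scheme.IdealSheafData.le_support_iff_le_vanishingIdeal.mpr hle
    rintro _ ⟨y, hy, rfl⟩
    have h3 : y ∈ (((vanishingIdeal (closureImage φ ((AffineCoordBlowup.𝓘Λ 4 K
          (insert 0 (Fin.succ '' (S' : Set (Fin 4))))).support : Set (P 4 K)))).comap π₂).comap
          (Spec.map (CommRingCat.ofHom (Θ' : A 4 K →+* A 4 K)) ≫
            AffineCoordBlowup.chartImm (isBlowup_restrict_globalCentre φ _ hπ₂) (succ_mem_centreVars hj') ≫
              (π₂ ⁻¹ᵁ φ.opensRange).ι)).support := hsupp hy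
    rw [Scheme.IdealSheafData.support_comap, Scheme.IdealSheafData.support_comap] at h3
    have h4 : π₂ ((Spec.map (CommRingCat.ofHom (Θ' : A 4 K →+* A 4 K)) ≫
        AffineCoordBlowup.chartImm (isBlowup_restrict_globalCentre φ _ hπ₂) (succ_mem_centreVars hj') ≫
          (π₂ ⁻¹ᵁ φ.opensRange).ι) y) ∈
        ((vanishingIdeal (closureImage φ ((AffineCoordBlowup.𝓘Λ 4 K
          (insert 0 (Fin.succ '' (S' : Set (Fin 4))))).support : Set (P 4 K)))).support : Set Z) := h3
    rwa [coe_support_globalCentre φ hT] at h4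
  -- (iii) the composite chart is `ι ∘ (Spec Θ' ≫ chartImm)`; closure inside `range ι = π₂⁻¹ φ(𝔸⁵)`
  have hcomp : ((Spec.map (CommRingCat.ofHom (Θ' : A 4 K →+* A 4 K)) ≫
        AffineCoordBlowup.chartImm (isBlowup_restrict_globalCentre φ _ hπ₂) (succ_mem_centreVars hj') ≫
          (π₂ ⁻¹ᵁ φ.opensRange).ι : P 4 K ⟶ W₂) : P 4 K → W₂) =
      (π₂ ⁻¹ᵁ φ.opensRange).ι ∘ (Spec.map (CommRingCat.ofHom (Θ' : A 4 K →+* A 4 K)) ≫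
        AffineCoordBlowup.chartImm (isBlowup_restrict_globalCentre φ _ hπ₂) (succ_mem_centreVars hj')) :=
    funext fun y => by simp only [Function.comp_apply, Scheme.Hom.comp_apply]
  rw [hcomp, Set.image_comp] at h2 ⊢
  refine isClosed_image_of_isInducing (π₂ ⁻¹ᵁ φ.opensRange).ι.isOpenEmbedding.isInducing h1 ?_
  refine ((hT.preimage π₂.continuous).closure_subset_iff.mpr h2).trans ?_
  rintro w ⟨y, -, hy⟩
  rw [Scheme.Opens.range_ι]
  exact ⟨y, hy⟩

end Step

/-! ## §3 The induction step of the coordinate-centre chain (any ambient) -/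

section ChainStep

variable {K : Type} [Field K] {p : ℕ} [Fact p.Prime] [CharP K p] [PerfectRing K p] [DecidableEq K]
  {X₀ Z W₂ : Scheme.{0}} (φ : P 4 K ⟶ Z) [IsOpenImmersion φ] {π₂ : W₂ ⟶ Z} {S' : Finset (Fin 4)} {j' : Fin 4}

/-- **THE INDUCTION STEP OF THE COORDINATE-CENTRE CHAIN (re-entrant form).** Data — INVARIANT(Z, φ, M, s₁, S'):
a multiple blow-up `M₀ ⇝ M` (`IsMultipleBlowup M₀ σ M`, `M` on a locally Noetherian `Z`, `HasSNC M.boundary`), an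
open-immersion chart `φ : 𝔸⁵_K ⟶ Z` on which `M` (multiplicity `p`) reads `(z^p + s₁.F)·𝒪`, a coordinate centre
`S'` with `p ≤ ord_{(x_{S'})} s₁.F` whose chart image `φ(V(z, x_{S'}))` is CLOSED in `Z`, and (FC-1 input) the
simple normal crossings of `φ^*(M.boundary)` with `V(z, x_{S'})`. Then for ANY blowing up `π₂ : W₂ → Z` along the
global centre `Z_c`: (i) `IsMultipleBlowup M₀ (π₂ ≫ σ) M₂`, `M₂ = M.transform π₂ Z_c`, and `HasSNC M₂.boundary`;
(ii) for every `j' ∈ S'` and every point `b'` of the new exceptional hyperplane (`b'_{j'} = 0`) there is a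
re-centring `Θ'` such that on `φ'' = Spec Θ' ≫ chartImm_{j'} ≫ (π₂⁻¹ φ(𝔸⁵) ↪ W₂)`: `M₂` reads
`(z^p + (CentreBlowup.step p S' j' b' s₁).F)·𝒪`, the new exceptional divisor reads `V(x_{j'})`, and
`φ''(V(z, x_{S''}))` is CLOSED in `W₂` for EVERY `S'' ⊇ S'` — INVARIANT(W₂, φ'', M₂, step p S' j' b' s₁, S'')
again, for every next centre `S'' ⊇ S'` that the walk finds Hironaka-permissible. -/
theorem coord_chain_step [IsLocallyNoetherian Z] {M₀ : MarkedIdeal X₀} {σ : Z ⟶ X₀} {M : MarkedIdeal Z}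
    (hσ : IsMultipleBlowup M₀ σ M) (hE : HasSNC M.boundary) (hmult : M.mult = p) (s₁ : State K)
    (hM : M.ideal.comap φ = hypSheaf p s₁.F)
    (hperm' : (p : ℕ∞) ≤ CentreBlowup.ordAlong S' s₁.F)
    (hT : IsClosed (φ '' (AffineCoordBlowup.CΛ 4 K (insert 0 (Fin.succ '' (S' : Set (Fin 4)))) : Set (P 4 K))))
    (hEc : HasSNCWith (M.boundary.map (·.comap φ))
      (AffineCoordBlowup.𝓘Λ 4 K (insert 0 (Fin.succ '' (S' : Set (Fin 4))))))
    (hπ₂ : IsBlowup π₂ (vanishingIdeal (closureImage φ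
      ((AffineCoordBlowup.𝓘Λ 4 K (insert 0 (Fin.succ '' (S' : Set (Fin 4))))).support : Set (P 4 K)))))
    (hj' : j' ∈ S') {b' : Fin 4 → K} (hbj' : b' j' = 0) :
    IsMultipleBlowup M₀ (π₂ ≫ σ) (M.transform π₂ (vanishingIdeal (closureImage φ
        ((AffineCoordBlowup.𝓘Λ 4 K (insert 0 (Fin.succ '' (S' : Set (Fin 4))))).support : Set (P 4 K))))) ∧
      HasSNC (M.transform π₂ (vanishingIdeal (closureImage φ
        ((AffineCoordBlowup.𝓘Λ 4 K (insert 0 (Fin.succ '' (S' : Set (Fin 4))))).support : Set (P 4 K))))).boundary ∧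
      ∃ (Θ' : A 4 K ≃ₐ[K] A 4 K) (h' : MvPolynomial (Fin 4) K),
        Θ' (X 0) = X 0 + rename Fin.succ h' ∧ (∀ i : Fin 4, Θ' (X i.succ) = X i.succ + C (b' i)) ∧
        (M.transform π₂ (vanishingIdeal (closureImage φ
          ((AffineCoordBlowup.𝓘Λ 4 K (insert 0 (Fin.succ '' (S' : Set (Fin 4))))).support : Set (P 4 K))))).ideal.comap
          (Spec.map (CommRingCat.ofHom (Θ' : A 4 K →+* A 4 K)) ≫
            AffineCoordBlowup.chartImm (isBlowup_restrict_globalCentre φ _ hπ₂) (succ_mem_centreVars hj') ≫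
              (π₂ ⁻¹ᵁ φ.opensRange).ι) =
          hypSheaf p (CentreBlowup.step p S' j' b' s₁).F ∧
        ((vanishingIdeal (closureImage φ
          ((AffineCoordBlowup.𝓘Λ 4 K (insert 0 (Fin.succ '' (S' : Set (Fin 4))))).support : Set (P 4 K)))).comap π₂).comap
          (Spec.map (CommRingCat.ofHom (Θ' : A 4 K →+* A 4 K)) ≫
            AffineCoordBlowup.chartImm (isBlowup_restrict_globalCentre φ _ hπ₂) (succ_mem_centreVars hj') ≫
              (π₂ ⁻¹ᵁ φ.opensRange).ι) =
          ofIdealTop (Ideal.span {coord 4 K j'.succ}) ∧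
        ∀ S'' : Finset (Fin 4), S' ⊆ S'' →
          IsClosed ((Spec.map (CommRingCat.ofHom (Θ' : A 4 K →+* A 4 K)) ≫
              AffineCoordBlowup.chartImm (isBlowup_restrict_globalCentre φ _ hπ₂) (succ_mem_centreVars hj') ≫
                (π₂ ⁻¹ᵁ φ.opensRange).ι) ''
            (AffineCoordBlowup.CΛ 4 K (insert 0 (Fin.succ '' (S'' : Set (Fin 4)))) : Set (P 4 K))) := by
  haveI : IsProper π₂ := hπ₂.isProper
  haveI : IsLocallyNoetherian W₂ := LocallyOfFiniteType.isLocallyNoetherian π₂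
  obtain ⟨Θ', h', h0', hs', hc⟩ := transform_ideal_chart_of_chart φ M hmult s₁ hM hπ₂ hj' hbj' hperm'
  have hΘ'j : (Θ' : A 4 K →+* A 4 K) (X j'.succ) = X j'.succ := by
    rw [show (Θ' : A 4 K →+* A 4 K) (X j'.succ) = Θ' (X j'.succ) from rfl, hs' j', hbj', C_0, add_zero]
  exact ⟨isMultipleBlowup_extend_coord φ hσ hmult hM hperm' hT hE hEc hπ₂,
    MarkedIdeal.hasSNC_transform_boundary M (hasSNCWith_globalCentre φ hT hE hEc) hπ₂,
    Θ', h', h0', hs', hc, comap_comap_globalCentre_chart_of_chart φ hj' hΘ'j hπ₂,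
    fun S'' hsub => isClosed_image_CΛ_chart_of_chart φ hT hπ₂ hj' hbj' h0' hs' hsub⟩

end ChainStep

end ChartDictionary

end Summit.ResolutionOfSingularities.ResolutionOfSingularities.Theorems.PIDim4

end
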